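import Literature.Computability.AlgebraicComplexity.UABPZCoefficients
import Mathlib.RingTheory.MvPolynomial.EulerIdentity
import HarnessLib

/-!
# DDS 2021, proof of Thm. 3.2: the bridge between the `z`-frame and the graded `x`-frame
# (`z^c`-coefficients of `Φ_α(f)` = homogeneous components of `f(x + α)`; "mod `z^N`" = degree `< N`;
# `z∂_z` = Euler operator)

Theorem-only bridge file (cell `val-lit`, row X2-DDS21, RULING (132)(b); 0 definitions, 0 named
facts). Source: [DuttaDwivediSaxena2022] full version, proof of Thm. 3.2: the DiDIL map
"`Φ : x_i ↦ z · x_i + α_i`" (p0028 L751–757), the rings "`R_j = F[z]/⟨z^{d_j}⟩`" (p0028 L755,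
p0030 L800–812), the `z`-expansions "`∑_i (…) z^i`" (Claim 3.7, p0034 L904–913) and the operator
"dlog / `∂_z`" of the DiDIL step (p0030 L811 – p0033 L887).

Two currencies are in use for this proof in the tree: the **`z`-frame** of the landed ABP calculus
(`UABPToolkit.lean` L6–L8, `DegreeOfTruncation.lean`, `DDS21TraceBackFinalStep.lean`,
`UABPZCoefficients.lean`: `z = x_0` of `MvPolynomial (Fin (n+1)) F`, slices
`weightedHomogeneousComponent (Pi.single 0 1) c`, truncation `truncDegreeOf 0 N`, `z`-coefficients
`Polynomial.coeff (finSuccEquiv F n ·) c`), and the **graded `x`-frame** of the DiDIL bricks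
(pre-shift by `α`, no `z`, grade by total degree: `homogeneousComponent c (f(x + α))`, Euler operator
`∑_i x_i ∂_i`). This file proves that they carry the same data:

* `aeval_phi_eq_dilate_shift`, `dilate_eq_sum`, `aeval_phi_eq_sum`: `Φ_α = (dilation x_i ↦ z x_{i+1}) ∘
  (shift x ↦ x + α)` and `Φ_α(f) = ∑_c z^c · rename succ ((f(x+α))_c)`;
* ★ `finSuccEquiv_dilate_coeff`, ★ `finSuccEquiv_aeval_phi_coeff`: the `z^c`-coefficient of `Φ_α(f)`
  IS `homogeneousComponent c (f(x + α))`; `weightedHomogeneousComponent_aeval_phi` (slice form);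
* ★ `truncDegreeOf_zero_aeval_phi`: "`Φ_α(f) mod z^N`" = `∑_{c<N} z^c · rename succ ((f(x+α))_c)`
  (+ `finSuccEquiv_truncDegreeOf_zero_aeval_phi_coeff`, coefficient form);
* the `z = 0` values: `homogeneousComponent_zero_shift` (`(f(x+α))_0 = C (f α)`),
  ★ `finSuccEquiv_aeval_phi_coeff_zero`, ★ `truncDegreeOf_one_aeval_phi_eq_C_eval`
  (`Φ_α(f) mod z = C (f α)`, any commutative semiring),
  `weightedHomogeneousComponent_zero_aeval_phi`;
* Euler ↔ `z∂_z`: `homogeneousComponent_sum_X_mul_pderiv` (`(∑_i x_i ∂_i g)_c = c · g_c`),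
  `finSuccEquiv_pderiv_zero`, `finSuccEquiv_coeff_X_zero_mul_pderiv_zero`
  (`coeff_c (z ∂_z F) = c · coeff_c F`), `weightedHomogeneousComponent_X_zero_mul_pderiv_zero`,
  ★ `X_zero_mul_pderiv_zero_dilate` (`z ∂_z ∘ dilation = dilation ∘ ∑_i x_i ∂_i`),
  ★ `X_zero_mul_pderiv_zero_aeval_phi`, `finSuccEquiv_X_zero_mul_pderiv_zero_aeval_phi_coeff`.

* shift/unshift `aeval_X_sub_C_aeval_X_add_C`, `aeval_X_add_C_aeval_X_sub_C` (`CommRing`), and on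
  programs: `UABPComputesLen.aeval_X_add_C` (the shift is free: same budget, same length),
  `UABPComputesLen.homogeneousComponent_aeval_X_add_C` (`(f(x+α))_k`, `k ≤ D`, within `S · (D+1)`),
  their `UABPComputes` forms.

The Euler operator is written out as `∑ i, X i * pderiv i` (no definition is introduced here), so a
later `def euler` unfolds to these statements.

Honest framing: plumbing toward the x-row `DDS2021_thm_3_2` (OPEN by name); `VP ≠ VNP` is NOT
proved and nothing here bears on it.
-/

open MvPolynomial

namespace Literature.Computability.AlgebraicComplexity

namespace DDS2021

section Algebra

variable {R : Type*} [CommSemiring R] {n : ℕ}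

/-! ### The dilation `x_i ↦ z · x_{i+1}` and the shift `x ↦ x + α` -/

/-- On a homogeneous polynomial of degree `k`, the dilation `x_i ↦ z · x_{i+1}` (`z = x_0`) acts
as `z^k · (rename Fin.succ)` (the map `Φ` at `α = 0`, degree by degree).
[cite: DuttaDwivediSaxena2022, §3 proof of Thm. 3.2, "`Φ : x_i ↦ z · x_i + α_i`" (full version p0028 L751–757)] -/
theorem bind₁_X_zero_mul_X_succ_of_isHomogeneous {k : ℕ} {g : MvPolynomial (Fin n) R}
    (hg : g.IsHomogeneous k) :
    bind₁ (fun i : Fin n => (X 0 * X i.succ : MvPolynomial (Fin (n + 1)) R)) g =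
      (X 0 : MvPolynomial (Fin (n + 1)) R) ^ k * rename Fin.succ g := by
  classical
  conv_lhs => rw [g.as_sum]
  conv_rhs => rw [g.as_sum]
  rw [map_sum, map_sum, Finset.mul_sum]
  refine Finset.sum_congr rfl fun d hd => ?_
  have hdeg : ∑ i ∈ d.support, d i = k := by
    have h := hg (mem_support_iff.1 hd)
    simpa [Finsupp.weight_apply, Finsupp.sum] using h
  rw [bind₁_monomial, rename_monomial, monomial_eq, Finsupp.prod_mapDomain_index_inj
    (Fin.succ_injective n)]
  simp only [mul_pow, Finset.prod_mul_distrib, Finset.prod_pow_eq_pow_sum, hdeg, Finsupp.prod]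
  ring

/-- **The dilation, graded**: `g(z · x) = ∑_{k ≤ deg g} z^k · rename succ (g_k)` (the map `Φ` at
`α = 0`). [cite: DuttaDwivediSaxena2022, §3 proof of Thm. 3.2, "`Φ : x_i ↦ z · x_i + α_i`" (full version p0028 L751–757)] -/
theorem dilate_eq_sum (g : MvPolynomial (Fin n) R) :
    bind₁ (fun i : Fin n => (X 0 * X i.succ : MvPolynomial (Fin (n + 1)) R)) g =
      ∑ k ∈ Finset.range (g.totalDegree + 1),
        (X 0 : MvPolynomial (Fin (n + 1)) R) ^ k * rename Fin.succ (homogeneousComponent k g) := by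
  conv_lhs => rw [← sum_homogeneousComponent g]
  rw [map_sum]
  exact Finset.sum_congr rfl fun k _ =>
    bind₁_X_zero_mul_X_succ_of_isHomogeneous (homogeneousComponent_isHomogeneous k g)

/-- ★ **The `z^k`-coefficient of the dilation `g(z · x)` is the homogeneous component `g_k`**
("`z`" as the degree counter of `Φ`).
[cite: DuttaDwivediSaxena2022, §3 proof of Thm. 3.2 (full version p0028 L751–757; Claim 3.7, p0034 L904–913)] -/
theorem finSuccEquiv_dilate_coeff (g : MvPolynomial (Fin n) R) (k : ℕ) :
    Polynomial.coeff (finSuccEquiv R n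
        (bind₁ (fun i : Fin n => (X 0 * X i.succ : MvPolynomial (Fin (n + 1)) R)) g)) k =
      homogeneousComponent k g := by
  classical
  ext m
  rw [finSuccEquiv_coeff_coeff, dilate_eq_sum, coeff_sum]
  simp_rw [coeff_X_pow_mul_rename_succ, Finsupp.cons_zero, Finsupp.tail_cons]
  rw [Finset.sum_ite_eq]
  split_ifs with h
  · rfl
  · rw [Finset.mem_range, not_lt] at h
    rw [homogeneousComponent_eq_zero _ _ (by omega), coeff_zero]

/-- **`Φ_α = (dilation) ∘ (shift)`**: `f(z · x + α)` is the dilation of `f(x + α)`.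
[cite: DuttaDwivediSaxena2022, §3 proof of Thm. 3.2, "`Φ : x_i ↦ z · x_i + α_i`" (full version p0028 L751–757)] -/
theorem aeval_phi_eq_dilate_shift (f : MvPolynomial (Fin n) R) (α : Fin n → R) :
    aeval (fun i : Fin n => (X 0 * X i.succ + C (α i) : MvPolynomial (Fin (n + 1)) R)) f =
      bind₁ (fun i : Fin n => (X 0 * X i.succ : MvPolynomial (Fin (n + 1)) R))
        (aeval (fun i : Fin n => (X i + C (α i) : MvPolynomial (Fin n) R)) f) := by
  have hfun : (fun i : Fin n => (X 0 * X i.succ + C (α i) : MvPolynomial (Fin (n + 1)) R)) =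
      fun i => bind₁ (fun j : Fin n => (X 0 * X j.succ : MvPolynomial (Fin (n + 1)) R))
        (X i + C (α i)) := by
    funext i
    simp
  rw [aeval_eq_bind₁, aeval_eq_bind₁, bind₁_bind₁, hfun]

/-- **`Φ_α(f) = ∑_k z^k · rename succ ((f(x + α))_k)`**, the sum over `k ≤ deg f(x + α)`.
[cite: DuttaDwivediSaxena2022, §3 proof of Thm. 3.2 (full version p0028 L751–757)] -/
theorem aeval_phi_eq_sum (f : MvPolynomial (Fin n) R) (α : Fin n → R) :
    aeval (fun i : Fin n => (X 0 * X i.succ + C (α i) : MvPolynomial (Fin (n + 1)) R)) f =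
      ∑ k ∈ Finset.range
          ((aeval (fun i : Fin n => (X i + C (α i) : MvPolynomial (Fin n) R)) f).totalDegree + 1),
        (X 0 : MvPolynomial (Fin (n + 1)) R) ^ k * rename Fin.succ
          (homogeneousComponent k
            (aeval (fun i : Fin n => (X i + C (α i) : MvPolynomial (Fin n) R)) f)) := by
  rw [aeval_phi_eq_dilate_shift, dilate_eq_sum]

/-- ★ **Frame dictionary**: the `z^k`-coefficient of `Φ_α(f) = f(z · x + α)` is the degree-`k`
homogeneous component of the shift `f(x + α)`.
[cite: DuttaDwivediSaxena2022, §3 proof of Thm. 3.2 (full version p0028 L751–757 and Claim 3.7, p0034 L904–913)] -/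
theorem finSuccEquiv_aeval_phi_coeff (f : MvPolynomial (Fin n) R) (α : Fin n → R) (k : ℕ) :
    Polynomial.coeff (finSuccEquiv R n
        (aeval (fun i : Fin n => (X 0 * X i.succ + C (α i) : MvPolynomial (Fin (n + 1)) R)) f)) k =
      homogeneousComponent k
        (aeval (fun i : Fin n => (X i + C (α i) : MvPolynomial (Fin n) R)) f) := by
  rw [aeval_phi_eq_dilate_shift, finSuccEquiv_dilate_coeff]

/-- The `z`-degree-`k` slice of `Φ_α(f)` is `z^k · rename succ ((f(x + α))_k)`.
[cite: DuttaDwivediSaxena2022, §3 proof of Thm. 3.2 (full version p0028 L751–757)] -/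
theorem weightedHomogeneousComponent_aeval_phi (f : MvPolynomial (Fin n) R) (α : Fin n → R)
    (k : ℕ) :
    weightedHomogeneousComponent (Pi.single 0 1) k
        (aeval (fun i : Fin n => (X 0 * X i.succ + C (α i) : MvPolynomial (Fin (n + 1)) R)) f) =
      (X 0 : MvPolynomial (Fin (n + 1)) R) ^ k * rename Fin.succ
        (homogeneousComponent k
          (aeval (fun i : Fin n => (X i + C (α i) : MvPolynomial (Fin n) R)) f)) := by
  rw [weightedHomogeneousComponent_single_zero_eq, finSuccEquiv_aeval_phi_coeff]

/-- ★ **"`Φ_α(f) mod z^N`" is the degree-`< N` part of `f(x + α)`, dilated**: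
`truncDegreeOf 0 N (Φ_α f) = ∑_{k < N} z^k · rename succ ((f(x + α))_k)`.
[cite: DuttaDwivediSaxena2022, §3 proof of Thm. 3.2 (full version p0028 L755 "`R_0 := F[z]/⟨z^d⟩`", p0030 L800–812)] -/
theorem truncDegreeOf_zero_aeval_phi (f : MvPolynomial (Fin n) R) (α : Fin n → R) (N : ℕ) :
    Literature.RingTheory.MvPolynomial.truncDegreeOf 0 N
        (aeval (fun i : Fin n => (X 0 * X i.succ + C (α i) : MvPolynomial (Fin (n + 1)) R)) f) =
      ∑ k ∈ Finset.range N, (X 0 : MvPolynomial (Fin (n + 1)) R) ^ k * rename Fin.succ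
        (homogeneousComponent k
          (aeval (fun i : Fin n => (X i + C (α i) : MvPolynomial (Fin n) R)) f)) := by
  classical
  rw [Literature.RingTheory.MvPolynomial.truncDegreeOf_apply]
  exact Finset.sum_congr rfl fun k _ => weightedHomogeneousComponent_aeval_phi f α k

/-- "`Φ_α(f) mod z^N`" in `z`-coefficients: `coeff_k = (f(x+α))_k` for `k < N`, else `0`.
[cite: DuttaDwivediSaxena2022, §3 proof of Thm. 3.2 (full version p0028 L755, p0030 L800–812)] -/
theorem finSuccEquiv_truncDegreeOf_zero_aeval_phi_coeff (f : MvPolynomial (Fin n) R)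
    (α : Fin n → R) (N k : ℕ) :
    Polynomial.coeff (finSuccEquiv R n (Literature.RingTheory.MvPolynomial.truncDegreeOf 0 N
        (aeval (fun i : Fin n => (X 0 * X i.succ + C (α i) : MvPolynomial (Fin (n + 1)) R)) f))) k =
      if k < N then homogeneousComponent k
        (aeval (fun i : Fin n => (X i + C (α i) : MvPolynomial (Fin n) R)) f) else 0 := by
  classical
  ext m
  rw [finSuccEquiv_coeff_coeff, Literature.RingTheory.MvPolynomial.coeff_truncDegreeOf,
    Finsupp.cons_zero]
  split_ifs with h
  · rw [← finSuccEquiv_coeff_coeff, finSuccEquiv_aeval_phi_coeff]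
  · rw [coeff_zero]

/-! ### The `z = 0` values -/

/-- The constant term of the shift is the value: `(f(x + α))_0 = f(α)` (what "`z = 0`" reads off).
[cite: DuttaDwivediSaxena2022, §3 proof of Thm. 3.2 (full version p0030 L808–812, "`z = 0`" evaluation)] -/
theorem homogeneousComponent_zero_shift (f : MvPolynomial (Fin n) R) (α : Fin n → R) :
    homogeneousComponent 0 (aeval (fun i : Fin n => (X i + C (α i) : MvPolynomial (Fin n) R)) f) =
      C (eval α f) := by
  rw [homogeneousComponent_zero]
  congr 1
  have h1 : coeff 0 (aeval (fun i : Fin n => (X i + C (α i) : MvPolynomial (Fin n) R)) f) =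
      aeval (0 : Fin n → R) (aeval (fun i : Fin n => (X i + C (α i) : MvPolynomial (Fin n) R)) f) := by
    rw [aeval_zero, Algebra.algebraMap_self_apply]
    rfl
  rw [h1, aeval_eq_bind₁ (fun i : Fin n => (X i + C (α i) : MvPolynomial (Fin n) R)), aeval_bind₁]
  simp

/-- ★ **`Φ_α(f)|_{z=0} = f(α)`**: the `z^0`-coefficient of `Φ_α(f)` is the constant `f(α)`
("`Φ(f)(z = 0) = f(α)`", the unit/value read off at `z = 0` in the DiDIL step).
[cite: DuttaDwivediSaxena2022, §3 proof of Thm. 3.2 (full version p0028 L751–757, p0030 L808–812)] -/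
theorem finSuccEquiv_aeval_phi_coeff_zero (f : MvPolynomial (Fin n) R) (α : Fin n → R) :
    Polynomial.coeff (finSuccEquiv R n
        (aeval (fun i : Fin n => (X 0 * X i.succ + C (α i) : MvPolynomial (Fin (n + 1)) R)) f)) 0 =
      C (eval α f) := by
  rw [finSuccEquiv_aeval_phi_coeff, homogeneousComponent_zero_shift]

/-- ★ **"`Φ_α(f) mod z`" is the constant `f(α)`**: `truncDegreeOf 0 1 (Φ_α f) = C (f(α))`, over any
commutative semiring (the `Field` case, by induction on `f`, is
`DDS2021.truncDegreeOf_one_aeval_phi` of `DDS21TraceBackStep.lean`; this is the graded proof).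
[cite: DuttaDwivediSaxena2022, §3 proof of Thm. 3.2 (full version p0028 L755, p0030 L808–812)] -/
theorem truncDegreeOf_one_aeval_phi_eq_C_eval (f : MvPolynomial (Fin n) R) (α : Fin n → R) :
    Literature.RingTheory.MvPolynomial.truncDegreeOf 0 1
        (aeval (fun i : Fin n => (X 0 * X i.succ + C (α i) : MvPolynomial (Fin (n + 1)) R)) f) =
      C (eval α f) := by
  rw [truncDegreeOf_zero_aeval_phi, Finset.sum_range_one, pow_zero, one_mul,
    homogeneousComponent_zero_shift, rename_C]

/-- The `z`-degree-`0` slice of `Φ_α(f)` is the constant `f(α)`.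
[cite: DuttaDwivediSaxena2022, §3 proof of Thm. 3.2 (full version p0030 L808–812)] -/
theorem weightedHomogeneousComponent_zero_aeval_phi (f : MvPolynomial (Fin n) R) (α : Fin n → R) :
    weightedHomogeneousComponent (Pi.single 0 1) 0
        (aeval (fun i : Fin n => (X 0 * X i.succ + C (α i) : MvPolynomial (Fin (n + 1)) R)) f) =
      C (eval α f) := by
  rw [weightedHomogeneousComponent_aeval_phi, pow_zero, one_mul, homogeneousComponent_zero_shift,
    rename_C]

/-! ### Euler operator `∑_i x_i ∂_i` ↔ `z ∂_z` -/

/-- **Euler's identity on homogeneous components**: `(∑_i x_i ∂_i g)_j = j · g_j`.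
(`CommSemiring` form of `MS2021.homogeneousComponent_sum_X_mul_pderiv`, restated in 20 lines rather
than importing the Medini–Shpilka chain into the DDS cone; Mathlib `IsHomogeneous.sum_X_mul_pderiv`
componentwise.) This is the graded-`x`-frame rendering (RULING (132)(a)) of the operator `z ∂_z` of
the DiDIL step. [cite: DuttaDwivediSaxena2022, §3 proof of Thm. 3.2 (full version p0030 L811–812 and p0032 L858–871: "`∂_z`", dlog)] -/
theorem homogeneousComponent_sum_X_mul_pderiv (g : MvPolynomial (Fin n) R) (j : ℕ) :
    homogeneousComponent j (∑ i, X i * pderiv i g) = j • homogeneousComponent j g := by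
  classical
  have key : (∑ i, X i * pderiv i g) =
      ∑ k ∈ Finset.range (g.totalDegree + 1), k • homogeneousComponent k g := by
    conv_lhs => rw [← sum_homogeneousComponent g]
    simp_rw [map_sum, Finset.mul_sum]
    rw [Finset.sum_comm]
    refine Finset.sum_congr rfl fun k _ => ?_
    exact (homogeneousComponent_isHomogeneous k g).sum_X_mul_pderiv
  rw [key, map_sum]
  simp_rw [map_nsmul]
  rw [Finset.sum_eq_single j]
  · rw [homogeneousComponent_of_mem (homogeneousComponent_isHomogeneous j g), if_pos rfl]
  · intro k _ hk
    rw [homogeneousComponent_of_mem (homogeneousComponent_isHomogeneous k g), if_neg (Ne.symm hk),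
      smul_zero]
  · intro hj
    rw [Finset.mem_range, not_lt] at hj
    rw [homogeneousComponent_eq_zero j g (by omega), map_zero, smul_zero]

/-- `finSuccEquiv` turns `∂/∂z` (`z = x_0`) into the derivative of the univariate polynomial in `z`.
(Same statement as `Literature.Combinatorics.StablePolynomials.finSuccEquiv_pderiv_zero` and
`Literature.NumberTheory.DiophantineGeometry.finSuccEquiv_pderiv_zero`, here for a `CommSemiring`;
restated in 15 lines rather than importing either closure into this topic.)
[cite: DuttaDwivediSaxena2022, §3 proof of Thm. 3.2 (full version p0030 L811–812: "`∂_z`" on `F[z, x]`)] -/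
theorem finSuccEquiv_pderiv_zero (F : MvPolynomial (Fin (n + 1)) R) :
    finSuccEquiv R n (pderiv 0 F) = Polynomial.derivative (finSuccEquiv R n F) := by
  induction F using MvPolynomial.induction_on with
  | C a =>
    rw [pderiv_C, map_zero, ← MvPolynomial.algebraMap_eq, AlgEquiv.commutes,
      Polynomial.algebraMap_apply, Polynomial.derivative_C]
  | add p q hp hq => rw [map_add, map_add, map_add, hp, hq, Polynomial.derivative_add]
  | mul_X p i hp =>
    have hX : finSuccEquiv R n (pderiv 0 (X i)) =
        Polynomial.derivative (finSuccEquiv R n (X i)) := by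
      refine Fin.cases ?_ (fun j => ?_) i
      · rw [pderiv_X_self, map_one, finSuccEquiv_X_zero, Polynomial.derivative_X]
      · rw [pderiv_X_of_ne (Fin.succ_ne_zero j), map_zero, finSuccEquiv_X_succ,
          Polynomial.derivative_C]
    rw [Derivation.leibniz, smul_eq_mul, smul_eq_mul, map_add, map_mul, map_mul, hp, hX, map_mul,
      Polynomial.derivative_mul]
    ring

/-- **`coeff_k (z ∂_z F) = k · coeff_k F`** in `z`-coefficients.
[cite: DuttaDwivediSaxena2022, §3 proof of Thm. 3.2 (full version p0030 L811–812, p0032 L858–871)] -/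
theorem finSuccEquiv_coeff_X_zero_mul_pderiv_zero (F : MvPolynomial (Fin (n + 1)) R) (k : ℕ) :
    Polynomial.coeff (finSuccEquiv R n (X 0 * pderiv 0 F)) k =
      k • Polynomial.coeff (finSuccEquiv R n F) k := by
  rw [map_mul, finSuccEquiv_X_zero, finSuccEquiv_pderiv_zero]
  cases k with
  | zero => rw [Polynomial.coeff_X_mul_zero, zero_smul]
  | succ j =>
    rw [Polynomial.coeff_X_mul, Polynomial.coeff_derivative, ← Nat.cast_succ, ← nsmul_eq_mul']

/-- `(z ∂_z F)^{(z)}_k = k · F^{(z)}_k` on `z`-degree slices.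
[cite: DuttaDwivediSaxena2022, §3 proof of Thm. 3.2 (full version p0030 L811–812)] -/
theorem weightedHomogeneousComponent_X_zero_mul_pderiv_zero (F : MvPolynomial (Fin (n + 1)) R)
    (k : ℕ) :
    weightedHomogeneousComponent (Pi.single 0 1) k (X 0 * pderiv 0 F) =
      k • weightedHomogeneousComponent (Pi.single 0 1) k F := by
  rw [weightedHomogeneousComponent_single_zero_eq, weightedHomogeneousComponent_single_zero_eq,
    finSuccEquiv_coeff_X_zero_mul_pderiv_zero, map_nsmul, mul_smul_comm]

/-- ★ **`z ∂_z ∘ (dilation) = (dilation) ∘ ∑_i x_i ∂_i`**: on `g(z · x)` the operator `z ∂_z` is the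
Euler operator of `g` (the two frames' differential operators agree).
[cite: DuttaDwivediSaxena2022, §3 proof of Thm. 3.2 (full version p0030 L811–812, p0032 L858–871)] -/
theorem X_zero_mul_pderiv_zero_dilate (g : MvPolynomial (Fin n) R) :
    (X 0 : MvPolynomial (Fin (n + 1)) R) * pderiv 0
        (bind₁ (fun i : Fin n => (X 0 * X i.succ : MvPolynomial (Fin (n + 1)) R)) g) =
      bind₁ (fun i : Fin n => (X 0 * X i.succ : MvPolynomial (Fin (n + 1)) R))
        (∑ i, X i * pderiv i g) := by
  apply (finSuccEquiv R n).injective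
  ext k : 1
  rw [finSuccEquiv_coeff_X_zero_mul_pderiv_zero, finSuccEquiv_dilate_coeff,
    finSuccEquiv_dilate_coeff, homogeneousComponent_sum_X_mul_pderiv]

/-- ★ **Euler ↔ `z ∂_z` through `Φ_α`**: `z ∂_z (Φ_α f) = (dilation) (∑_i x_i ∂_i (f(x + α)))`.
[cite: DuttaDwivediSaxena2022, §3 proof of Thm. 3.2 (full version p0030 L811 – p0033 L887)] -/
theorem X_zero_mul_pderiv_zero_aeval_phi (f : MvPolynomial (Fin n) R) (α : Fin n → R) :
    (X 0 : MvPolynomial (Fin (n + 1)) R) * pderiv 0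
        (aeval (fun i : Fin n => (X 0 * X i.succ + C (α i) : MvPolynomial (Fin (n + 1)) R)) f) =
      bind₁ (fun i : Fin n => (X 0 * X i.succ : MvPolynomial (Fin (n + 1)) R))
        (∑ i, X i * pderiv i
          (aeval (fun i : Fin n => (X i + C (α i) : MvPolynomial (Fin n) R)) f)) := by
  rw [aeval_phi_eq_dilate_shift, X_zero_mul_pderiv_zero_dilate]

/-- In `z`-coefficients: `coeff_k (z ∂_z Φ_α(f)) = (∑_i x_i ∂_i (f(x+α)))_k = k · (f(x+α))_k`.
[cite: DuttaDwivediSaxena2022, §3 proof of Thm. 3.2 (full version p0030 L811 – p0033 L887)] -/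
theorem finSuccEquiv_X_zero_mul_pderiv_zero_aeval_phi_coeff (f : MvPolynomial (Fin n) R)
    (α : Fin n → R) (k : ℕ) :
    Polynomial.coeff (finSuccEquiv R n ((X 0 : MvPolynomial (Fin (n + 1)) R) * pderiv 0
        (aeval (fun i : Fin n => (X 0 * X i.succ + C (α i) : MvPolynomial (Fin (n + 1)) R)) f))) k =
      homogeneousComponent k (∑ i, X i * pderiv i
        (aeval (fun i : Fin n => (X i + C (α i) : MvPolynomial (Fin n) R)) f)) := by
  rw [X_zero_mul_pderiv_zero_aeval_phi, finSuccEquiv_dilate_coeff]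

/-! ### Shift and unshift -/

/-- `x_i + a` involves at most one variable (also over the trivial ring). [folklore] -/
private theorem card_vars_X_add_C_le_one (i : Fin n) (a : R) :
    (X i + C a : MvPolynomial (Fin n) R).vars.card ≤ 1 := by
  classical
  refine (Finset.card_le_card (vars_add_subset _ _)).trans ?_
  rw [vars_C, Finset.union_empty]
  rcases subsingleton_or_nontrivial R with hR | hR
  · have h0 : (X i : MvPolynomial (Fin n) R) = 0 := by
      rw [← one_mul (X i), ← C_1, Subsingleton.elim (1 : R) 0, C_0, zero_mul]
    simp [h0]
  · simp [vars_X]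

/-- `x_i + a` has total degree at most one (also over the trivial ring). [folklore] -/
private theorem totalDegree_X_add_C_le_one (i : Fin n) (a : R) :
    (X i + C a : MvPolynomial (Fin n) R).totalDegree ≤ 1 := by
  refine (totalDegree_add _ _).trans (max_le ?_ (by rw [totalDegree_C]; exact Nat.zero_le _))
  rcases subsingleton_or_nontrivial R with hR | hR
  · have h0 : (X i : MvPolynomial (Fin n) R) = 0 := by
      rw [← one_mul (X i), ← C_1, Subsingleton.elim (1 : R) 0, C_0, zero_mul]
    simp [h0]
  · simp [totalDegree_X]

end Algebra

section AlgebraRing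

variable {R : Type*} [CommRing R] {n : ℕ}

/-- Unshifting the shift: `(f(x + α))(x − α) = f` ("apply the map `Φ^{-1}`", its `x`-part).
[cite: DuttaDwivediSaxena2022, §3 proof of Thm. 3.2 (full version p0036 L959–961)] -/
theorem aeval_X_sub_C_aeval_X_add_C (f : MvPolynomial (Fin n) R) (α : Fin n → R) :
    aeval (fun i : Fin n => (X i - C (α i) : MvPolynomial (Fin n) R))
        (aeval (fun i : Fin n => (X i + C (α i) : MvPolynomial (Fin n) R)) f) = f := by
  rw [aeval_eq_bind₁, aeval_eq_bind₁, bind₁_bind₁]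
  have h : (fun i : Fin n => bind₁ (fun j : Fin n => (X j - C (α j) : MvPolynomial (Fin n) R))
      (X i + C (α i))) = X := by
    funext i
    simp
  rw [h, bind₁_X_left]
  rfl

/-- Shifting the unshift: `(f(x − α))(x + α) = f`.
[cite: DuttaDwivediSaxena2022, §3 proof of Thm. 3.2 (full version p0028 L751–757, p0036 L959–961)] -/
theorem aeval_X_add_C_aeval_X_sub_C (f : MvPolynomial (Fin n) R) (α : Fin n → R) :
    aeval (fun i : Fin n => (X i + C (α i) : MvPolynomial (Fin n) R))
        (aeval (fun i : Fin n => (X i - C (α i) : MvPolynomial (Fin n) R)) f) = f := by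
  rw [aeval_eq_bind₁, aeval_eq_bind₁, bind₁_bind₁]
  have h : (fun i : Fin n => bind₁ (fun j : Fin n => (X j + C (α j) : MvPolynomial (Fin n) R))
      (X i - C (α i))) = X := by
    funext i
    simp
  rw [h, bind₁_X_left]
  rfl

end AlgebraRing

section Programs

variable {F : Type*} [CommSemiring F] {n : ℕ}

/-- **The shift `x ↦ x + α` is free on programs** (same budget, same length): the graded
`x`-frame's basic object `f(x + α)` costs nothing on the ABP side.
[cite: DuttaDwivediSaxena2022, Lemma 2.6 proof (full version p0018 L486–498) and §3 proof of Thm. 3.2, "apply the map `Φ^{-1}`" (p0036 L959–961)] -/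
theorem UABPComputesLen.aeval_X_add_C {S L : ℕ} {f : MvPolynomial (Fin n) F}
    (hf : UABPComputesLen S L f) (α : Fin n → F) :
    UABPComputesLen S L (aeval (fun i : Fin n => (X i + C (α i) : MvPolynomial (Fin n) F)) f) := by
  rw [aeval_eq_bind₁]
  exact hf.bind₁_affine _ (fun j => card_vars_X_add_C_le_one j (α j))
    fun j => totalDegree_X_add_C_le_one j (α j)

/-- Length-free form of `UABPComputesLen.aeval_X_add_C`.
[cite: DuttaDwivediSaxena2022, Lemma 2.6 proof (full version p0018 L486–498)] -/
theorem UABPComputes.aeval_X_add_C {S : ℕ} {f : MvPolynomial (Fin n) F} (hf : UABPComputes S f)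
    (α : Fin n → F) :
    UABPComputes S (aeval (fun i : Fin n => (X i + C (α i) : MvPolynomial (Fin n) F)) f) := by
  obtain ⟨L, hf⟩ := hf.exists_len
  exact (hf.aeval_X_add_C α).uabpComputes

/-- **The graded `x`-frame objects have programs**: for `k ≤ D`, `(f(x + α))_k` — equivalently
(`finSuccEquiv_aeval_phi_coeff`) the `z^k`-coefficient of `Φ_α(f)` — is computed within budget
`S · (D + 1)`, same length.
[cite: DuttaDwivediSaxena2022, Lemma 2.6 and its proof (full version p0018 L481–498); §3 proof of Thm. 3.2, Claim 3.7 (p0034 L904–913)] -/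
theorem UABPComputesLen.homogeneousComponent_aeval_X_add_C {S L : ℕ} {f : MvPolynomial (Fin n) F}
    (hf : UABPComputesLen S L f) (α : Fin n → F) {D k : ℕ} (hk : k ≤ D) :
    UABPComputesLen (S * (D + 1)) L (MvPolynomial.homogeneousComponent k
      (aeval (fun i : Fin n => (X i + C (α i) : MvPolynomial (Fin n) F)) f)) :=
  (hf.aeval_X_add_C α).homogeneousComponent hk

/-- Length-free form of `UABPComputesLen.homogeneousComponent_aeval_X_add_C`.
[cite: DuttaDwivediSaxena2022, Lemma 2.6 and its proof (full version p0018 L481–498)] -/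
theorem UABPComputes.homogeneousComponent_aeval_X_add_C {S : ℕ} {f : MvPolynomial (Fin n) F}
    (hf : UABPComputes S f) (α : Fin n → F) {D k : ℕ} (hk : k ≤ D) :
    UABPComputes (S * (D + 1)) (MvPolynomial.homogeneousComponent k
      (aeval (fun i : Fin n => (X i + C (α i) : MvPolynomial (Fin n) F)) f)) :=
  (hf.aeval_X_add_C α).homogeneousComponent hk

end Programs

end DDS2021

end Literature.Computability.AlgebraicComplexity
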